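import Literature.Analysis.UnboundedOperators.LinearizedBoltzmannSymmetryProofs
import HarnessLib

/-!
# The linearised hard-sphere operator on `L²(M dv)`: Cauchy–Schwarz, growth of `L g`, orthogonality of its range to the null space

Topic: Analysis / UnboundedOperators (kinetic theory). Sibling proof file of
`Literature/Analysis/UnboundedOperators/LinearizedBoltzmann` (next to `LinearizedBoltzmannProofs`,
`…PositivityProofs`, `…SymmetryProofs`, `…BddAboveProofs`, `…IsotropyProofs`, `…BurnettProofs`).
The statement file vendors the named fact

* `bddAbove_range_dirichlet_of_orthogonal`: for `A` of temperate growth, `M`-orthogonal to the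
  collision invariants (velocity dimension `≥ 2`), the variational family
  `g ↦ 2⟪A, g⟫_M + ⟪g, L g⟫_M` (`g` of temperate growth, `L` the linearised hard-sphere operator)
  is bounded above, so that `dirichletFormInv L A = ⨆_g (2⟪A, g⟫_M + ⟪g, L g⟫_M) = ⟪A, (-L)⁻¹ A⟫_M`
  is the meaningful supremum (CIP 1994 §7.2) — "the spectral gap in disguise".

`LinearizedBoltzmannBddAboveProofs` proves it from the two named facts *symmetry*
(`maxwellianInner_linearizedCollisionOp_comm`, discharged in `LinearizedBoltzmannSymmetryProofs`)
and *spectral gap* (`le_neg_maxwellianInner_hardSphereLinearizedOp_of_orthogonal`, Baranger–Mouhot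
2005 Thm 1.1 / CIP 1994 Thm 7.2.5, undischarged), so that the fact now depends on the gap alone:
its discharge will be the one-liner
`bddAbove_range_dirichlet_of_orthogonal_of_comm_of_gap maxwellianInner_linearizedCollisionOp_comm_holds
le_neg_maxwellianInner_hardSphereLinearizedOp_of_orthogonal_holds`.

This file supplies the `L²(M dv)` infrastructure of CIP 1994 §7.1 around that fact which the
siblings do not contain and which the two remaining deep facts of the statement file (the gap and
the self-adjoint realisation `exists_isSelfAdjoint_hasCore`, whose first step is `L g ∈ L²(M)` for
`g` of temperate growth) require:

* `maxwellianInner_sq_le` — Cauchy–Schwarz `⟪f, g⟫_M² ≤ ‖f‖²_M ‖g‖²_M` on functions of temperate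
  growth (CIP 1994 (7.1.8), the Hilbert space `L²(M dv)`);
* `stronglyMeasurable_linearizedCollisionOp`, `exists_abs_linearizedCollisionOp_le`,
  `integrable_mul_linearizedCollisionOp`, `integrable_mul_hardSphereLinearizedOp` — for a
  measurable, polynomially bounded kernel and `g` of temperate growth, `L_B g` is measurable and
  polynomially bounded (so `L_B g ∈ L^p(M)` for all `p`), and `f · L_B g` is `M`-integrable for `f`
  of temperate growth (the pairings `⟪f, L_B g⟫_M` are genuine integrals and split additively);
* `maxwellianInner_hardSphereLinearizedOp_eq_zero_of_mem_collisionInvariants` (and `…_left_…`) —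
  `⟪p, L g⟫_M = ⟪L g, p⟫_M = 0` for a collision invariant `p`: the range of `L` is `M`-orthogonal
  to the null space (symmetry and `L p = 0`; CIP 1994 §7.1 p. 193, §7.2 Lemma 7.2.6).

This file declares theorems only (no definitions, no new named facts).

## References

* C. Cercignani, R. Illner, M. Pulvirenti, *The Mathematical Theory of Dilute Gases*, Springer
  (1994), §7.1 (7.1.6)–(7.1.10), pp. 192–193; §7.2 Thm 7.2.1, p. 197 and Thm 7.2.5, p. 201.
* C. Baranger, C. Mouhot, *Explicit spectral gap estimates for the linearized Boltzmann and Landau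
  operators with hard potentials*, Rev. Mat. Iberoam. 21 (2005), Thm 1.1.
-/

open MeasureTheory Metric Real ProbabilityTheory Module Set Filter
open scoped InnerProductSpace

namespace Literature.Analysis.UnboundedOperators

noncomputable section

open Literature.MathematicalPhysics.KineticTheory (collide sphereMeasure hardSphereKernel
  IsCollisionInvariant)
open Literature.Analysis.FluidPDE

variable {E : Type*} [NormedAddCommGroup E] [InnerProductSpace ℝ E] [FiniteDimensional ℝ E]
  [MeasurableSpace E] [BorelSpace E]

/-! ### Cauchy–Schwarz for the pairing on functions of temperate growth -/

/-- **Cauchy–Schwarz for the Maxwellian pairing** on functions of temperate growth: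
`⟪f, g⟫_M² ≤ ‖f‖²_M ‖g‖²_M` (the discriminant of `t ↦ ‖t f + g‖²_M ≥ 0`; CIP 1994 §7.1 (7.1.8),
the Hilbert space `L²(M dv)`). [folklore] -/
theorem maxwellianInner_sq_le {f g : E → ℝ} (hf : f ∈ temperateGrowth E)
    (hg : g ∈ temperateGrowth E) :
    maxwellianInner f g ^ 2 ≤ maxwellianInner f f * maxwellianInner g g := by
  have hf' := mem_temperateGrowth_iff.1 hf
  have hg' := mem_temperateGrowth_iff.1 hg
  have hff : Integrable (fun v => f v * f v) (stdGaussian E) :=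
    integrable_stdGaussian_of_hasTemperateGrowth (hf'.mul hf')
  have hfg : Integrable (fun v => f v * g v) (stdGaussian E) :=
    integrable_stdGaussian_of_hasTemperateGrowth (hf'.mul hg')
  have hgg : Integrable (fun v => g v * g v) (stdGaussian E) :=
    integrable_stdGaussian_of_hasTemperateGrowth (hg'.mul hg')
  have hquad : ∀ t : ℝ, 0 ≤ maxwellianInner f f * (t * t) + 2 * maxwellianInner f g * t +
      maxwellianInner g g := by
    intro t
    have hexp : maxwellianInner f f * (t * t) + 2 * maxwellianInner f g * t + maxwellianInner g g =
        ∫ v, (t * f v + g v) * (t * f v + g v) ∂stdGaussian E := by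
      have e1 : (fun v => (t * f v + g v) * (t * f v + g v)) =
          fun v => (t * t) * (f v * f v) + (2 * t) * (f v * g v) + g v * g v := by
        funext v; ring
      have h12 : Integrable (fun v => t * t * (f v * f v) + 2 * t * (f v * g v)) (stdGaussian E) :=
        (hff.const_mul (t * t)).add (hfg.const_mul (2 * t))
      rw [e1, integral_add h12 hgg, integral_add (hff.const_mul _) (hfg.const_mul _),
        integral_const_mul, integral_const_mul]
      simp only [maxwellianInner]
      ring
    rw [hexp]
    exact integral_nonneg fun v => mul_self_nonneg _
  have hd := discrim_le_zero hquad
  rw [discrim] at hd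
  nlinarith [hd]

/-! ### Measurability and growth of `L_B g` -/

section Operator

variable {B : E × E → sphere (0 : E) 1 → ℝ}

omit [FiniteDimensional ℝ E] [MeasurableSpace E] [BorelSpace E] in
/-- The linearised collision difference of a polynomially bounded function is polynomially
bounded: `|g' + g_*' - g - g_*| ≤ 4C ((1 + ‖v‖)(1 + ‖v_*‖))^k`. [folklore] -/
theorem abs_collisionDifference_le {g : E → ℝ} {C : ℝ} {k : ℕ} (hC : 0 ≤ C)
    (hg : ∀ x, |g x| ≤ C * (1 + ‖x‖) ^ k) (ω : sphere (0 : E) 1) (p : E × E) :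
    |g (collide ω p).1 + g (collide ω p).2 - g p.1 - g p.2| ≤
      4 * C * ((1 + ‖p.1‖) * (1 + ‖p.2‖)) ^ k := by
  have h := abs_collisionDiff_mul_le (h := fun _ => (1 : ℝ)) (C_h := 1) (b := 0) hC zero_le_one hg
    (fun u => by simp) p ω (one_add_norm_fst_le p)
  simpa using h

/-- **`L_B g` is strongly measurable** for a measurable kernel and continuous `g` (Fubini
measurability of parametric Bochner integrals, twice). [folklore] -/
theorem stronglyMeasurable_linearizedCollisionOp (hBm : Measurable (Function.uncurry B))
    {g : E → ℝ} (hg : Continuous g) : StronglyMeasurable (linearizedCollisionOp B g) := by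
  haveI := isFiniteMeasure_sphereMeasure (E := E)
  have hF : StronglyMeasurable fun q : (E × E) × sphere (0 : E) 1 =>
      B q.1 q.2 * (g (collide q.2 q.1).1 + g (collide q.2 q.1).2 - g q.1.1 - g q.1.2) := by
    refine (hBm.mul ?_).stronglyMeasurable
    exact (((hg.comp continuous_collide_uncurry.fst).add (hg.comp continuous_collide_uncurry.snd)).sub
      (hg.comp continuous_fst.fst)).sub (hg.comp continuous_fst.snd) |>.measurable
  have hG : StronglyMeasurable fun p : E × E => ∫ ω,
      B p ω * (g (collide ω p).1 + g (collide ω p).2 - g p.1 - g p.2) ∂sphereMeasure :=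
    hF.integral_prod_right'
  exact hG.integral_prod_right' (ν := stdGaussian E)

/-- **Polynomial growth of `L_B g`**: for a polynomially bounded kernel and `g` of temperate
growth, `|L_B g (v)| ≤ C (1 + ‖v‖)^m` (no measurability is needed: the Bochner integrals are
estimated by `norm_integral_le_of_norm_le`, using the Gaussian moments
`integrable_one_add_norm_pow_stdGaussian`; CIP 1994 §7.2, `K ∈ B(L^∞_β, L^∞_{β+1})`). [folklore] -/
theorem exists_abs_linearizedCollisionOp_le
    (hB : ∃ (k : ℕ) (C : ℝ), ∀ p ω, |B p ω| ≤ C * (1 + ‖p‖) ^ k) {g : E → ℝ}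
    (hg : g ∈ temperateGrowth E) :
    ∃ (m : ℕ) (C : ℝ), ∀ v, |linearizedCollisionOp B g v| ≤ C * (1 + ‖v‖) ^ m := by
  haveI := isFiniteMeasure_sphereMeasure (E := E)
  obtain ⟨kB, CB, hBle⟩ := hB
  obtain ⟨kg, Cg, hCg, hgle⟩ := exists_abs_le_of_hasTemperateGrowth (mem_temperateGrowth_iff.1 hg)
  set m : ℕ := kB + kg with hm
  set S : ℝ := (sphereMeasure : Measure (sphere (0 : E) 1)).real univ with hS
  set I : ℝ := ∫ w, (1 + ‖w‖) ^ m ∂stdGaussian E with hI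
  set C₁ : ℝ := |CB| * (4 * Cg) with hC₁
  refine ⟨m, C₁ * S * I, fun v => ?_⟩
  -- pointwise bound of the integrand
  have hpt : ∀ (w : E) (ω : sphere (0 : E) 1),
      |B (v, w) ω * (g (collide ω (v, w)).1 + g (collide ω (v, w)).2 - g v - g w)| ≤
        C₁ * ((1 + ‖v‖) ^ m * (1 + ‖w‖) ^ m) := by
    intro w ω
    set X : ℝ := (1 + ‖v‖) * (1 + ‖w‖) with hX
    have eB : |B (v, w) ω| ≤ |CB| * X ^ kB := by
      refine (hBle (v, w) ω).trans ((mul_le_mul_of_nonneg_right (le_abs_self CB)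
        (by positivity)).trans ?_)
      exact mul_le_mul_of_nonneg_left
        (pow_le_pow_left₀ (by positivity) (one_add_norm_prod_le (v, w)) kB) (abs_nonneg _)
    have eg := abs_collisionDifference_le hCg hgle ω (v, w)
    rw [abs_mul]
    calc |B (v, w) ω| * |g (collide ω (v, w)).1 + g (collide ω (v, w)).2 - g v - g w|
        ≤ (|CB| * X ^ kB) * (4 * Cg * X ^ kg) := mul_le_mul eB eg (abs_nonneg _) (by positivity)
      _ = C₁ * X ^ m := by rw [hm, pow_add, hC₁]; ring
      _ = C₁ * ((1 + ‖v‖) ^ m * (1 + ‖w‖) ^ m) := by rw [hX, mul_pow]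
  -- the inner integral
  have hinner : ∀ w : E, ‖∫ ω, B (v, w) ω * (g (collide ω (v, w)).1 + g (collide ω (v, w)).2
      - g v - g w) ∂sphereMeasure‖ ≤ C₁ * S * (1 + ‖v‖) ^ m * (1 + ‖w‖) ^ m := by
    intro w
    calc ‖∫ ω, B (v, w) ω * (g (collide ω (v, w)).1 + g (collide ω (v, w)).2 - g v - g w)
          ∂sphereMeasure‖
        ≤ ∫ _ω, C₁ * ((1 + ‖v‖) ^ m * (1 + ‖w‖) ^ m)
            ∂(sphereMeasure : Measure (sphere (0 : E) 1)) :=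
          norm_integral_le_of_norm_le (integrable_const _)
            (Eventually.of_forall fun ω => by rw [Real.norm_eq_abs]; exact hpt w ω)
      _ = C₁ * S * (1 + ‖v‖) ^ m * (1 + ‖w‖) ^ m := by
          rw [integral_const, smul_eq_mul, hS]; ring
  have hIi : Integrable (fun w : E => C₁ * S * (1 + ‖v‖) ^ m * (1 + ‖w‖) ^ m) (stdGaussian E) :=
    (integrable_one_add_norm_pow_stdGaussian m).const_mul _
  calc |linearizedCollisionOp B g v|
      = ‖∫ w, ∫ ω, B (v, w) ω * (g (collide ω (v, w)).1 + g (collide ω (v, w)).2 - g v - g w)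
          ∂sphereMeasure ∂stdGaussian E‖ := by rw [Real.norm_eq_abs]; rfl
    _ ≤ ∫ w, C₁ * S * (1 + ‖v‖) ^ m * (1 + ‖w‖) ^ m ∂stdGaussian E :=
        norm_integral_le_of_norm_le hIi (Eventually.of_forall hinner)
    _ = C₁ * S * I * (1 + ‖v‖) ^ m := by rw [integral_const_mul, hI]; ring

/-- **`f · L_B g` is `M`-integrable** for `f, g` of temperate growth and a measurable, polynomially
bounded kernel (so that the pairings `⟪f, L_B g⟫_M` are genuine integrals and split additively).
[folklore] -/
theorem integrable_mul_linearizedCollisionOp (hBm : Measurable (Function.uncurry B))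
    (hB : ∃ (k : ℕ) (C : ℝ), ∀ p ω, |B p ω| ≤ C * (1 + ‖p‖) ^ k) {f g : E → ℝ}
    (hf : f ∈ temperateGrowth E) (hg : g ∈ temperateGrowth E) :
    Integrable (fun v => f v * linearizedCollisionOp B g v) (stdGaussian E) := by
  obtain ⟨m, CL, hL⟩ := exists_abs_linearizedCollisionOp_le hB hg
  obtain ⟨kf, Cf, hCf, hfle⟩ := exists_abs_le_of_hasTemperateGrowth (mem_temperateGrowth_iff.1 hf)
  have hfc : Continuous f := (mem_temperateGrowth_iff.1 hf).1.continuous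
  have hgc : Continuous g := (mem_temperateGrowth_iff.1 hg).1.continuous
  refine Integrable.mono' ((integrable_one_add_norm_pow_stdGaussian (kf + m)).const_mul (Cf * CL))
    (hfc.aestronglyMeasurable.mul
      (stronglyMeasurable_linearizedCollisionOp hBm hgc).aestronglyMeasurable)
    (Eventually.of_forall fun v => ?_)
  rw [Real.norm_eq_abs, abs_mul, pow_add]
  calc |f v| * |linearizedCollisionOp B g v| ≤ (Cf * (1 + ‖v‖) ^ kf) * (CL * (1 + ‖v‖) ^ m) :=
        mul_le_mul (hfle v) (hL v) (abs_nonneg _) (by positivity)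
    _ = Cf * CL * ((1 + ‖v‖) ^ kf * (1 + ‖v‖) ^ m) := by ring

end Operator

/-! ### The hard-sphere kernel -/

omit [FiniteDimensional ℝ E] [MeasurableSpace E] [BorelSpace E] in
/-- Private helper (cf. `abs_hardSphereKernel_le` of the sibling `LinearizedBoltzmannBddAboveProofs`):
the polynomial bound of the hard-sphere kernel in the form used by the named facts,
`|((v - v_*)·ω)_+| ≤ 2 (1 + ‖(v, v_*)‖)^1`. [folklore] -/
private theorem exists_abs_hardSphereKernel_le_mul_pow :
    ∃ (k : ℕ) (C : ℝ), ∀ (p : E × E) (ω : sphere (0 : E) 1),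
      |hardSphereKernel p ω| ≤ C * (1 + ‖p‖) ^ k := by
  refine ⟨1, 2, fun p ω => ?_⟩
  rw [hardSphereKernel, abs_of_nonneg (le_max_right _ _), pow_one]
  refine max_le ?_ (by positivity)
  have h1 : ⟪p.1 - p.2, (ω : E)⟫_ℝ ≤ ‖p.1 - p.2‖ * ‖(ω : E)‖ := real_inner_le_norm _ _
  rw [norm_eq_of_mem_sphere ω, mul_one] at h1
  have h2 : ‖p.1 - p.2‖ ≤ ‖p.1‖ + ‖p.2‖ := norm_sub_le _ _
  have h3 : ‖p.1‖ ≤ ‖p‖ := norm_fst_le p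
  have h4 : ‖p.2‖ ≤ ‖p‖ := norm_snd_le p
  linarith [norm_nonneg p]

/-- `f · L g` is `M`-integrable for the linearised hard-sphere operator and `f, g` of temperate
growth. [folklore] -/
theorem integrable_mul_hardSphereLinearizedOp {f g : E → ℝ} (hf : f ∈ temperateGrowth E)
    (hg : g ∈ temperateGrowth E) :
    Integrable (fun v => f v * hardSphereLinearizedOp g v) (stdGaussian E) :=
  integrable_mul_linearizedCollisionOp isGradCutoffKernel_hardSphereKernel.measurable
    exists_abs_hardSphereKernel_le_mul_pow hf hg

/-! ### The collision invariants are `M`-orthogonal to the range of `L` -/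

/-- `⟪p, L g⟫_M = 0` for a collision invariant `p ∈ span {1, vᵢ, |v|²}` and `g` of temperate growth:
symmetry (`maxwellianInner_linearizedCollisionOp_comm_holds`) and `L p = 0`
(CIP 1994 §7.1, p. 193: the collision invariants span the null space and `L` is symmetric).
[cite: CIPDiluteGases1994, §7.1 (7.1.9) p. 193] -/
theorem maxwellianInner_hardSphereLinearizedOp_eq_zero_of_mem_collisionInvariants {p g : E → ℝ}
    (hp : p ∈ collisionInvariants E) (hg : g ∈ temperateGrowth E) :
    maxwellianInner p (hardSphereLinearizedOp g) = 0 := by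
  have hpT : p ∈ temperateGrowth E := collisionInvariants_le_temperateGrowth hp
  have hsymm := maxwellianInner_linearizedCollisionOp_comm_holds (E := E)
    isGradCutoffKernel_hardSphereKernel.measurable exists_abs_hardSphereKernel_le_mul_pow
    hardSphereKernel_collide_neg hardSphereKernel_swap_neg hg hpT
  have hLp : linearizedCollisionOp hardSphereKernel p = 0 :=
    linearizedCollisionOp_eq_zero_of_isCollisionInvariant _
      (isCollisionInvariant_of_mem_collisionInvariants hp)
  unfold hardSphereLinearizedOp
  rw [hsymm, hLp]
  simp [maxwellianInner]

/-- The range of `L` on functions of temperate growth is `M`-orthogonal to the collision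
invariants: `⟪L g, p⟫_M = 0` (CIP 1994 §7.1, p. 193). [cite: CIPDiluteGases1994, §7.1 (7.1.9) p. 193] -/
theorem maxwellianInner_hardSphereLinearizedOp_left_eq_zero_of_mem_collisionInvariants {p g : E → ℝ}
    (hp : p ∈ collisionInvariants E) (hg : g ∈ temperateGrowth E) :
    maxwellianInner (hardSphereLinearizedOp g) p = 0 := by
  rw [← maxwellianInner_hardSphereLinearizedOp_eq_zero_of_mem_collisionInvariants hp hg]
  simp only [maxwellianInner, mul_comm]

end

end Literature.Analysis.UnboundedOperators
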